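import Summits.AtomisticToContinuum.Crystallization.Theses.PhononSlackCertificates

/-!
# `PeriodicGivenLayered` / Negative: the ground-state hypothesis is load-bearing (spacing freedom)

Negative knowledge for crux `stmt-AtomisticToContinuum-11779` (`PhononSlackCertificates.PeriodicGivenLayered`,
shared with `HullMinimality`), crux-disprover seat `refuter-cdisprove-stmt-AtomisticToContinuum-11779-0`
(2026-08-16).  Nothing here closes an item; no theorem concludes a Theses decl positively.
* `HasLayeredWindows` / `HasPeriodicWindows`: hypothesis and conclusion of the crux for a given sequence,
  verbatim; `PeriodicGivenLayeredFor V` (at `lennardJones` it is the crux, `Iff.rfl`);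
  `PeriodicGivenLayeredWithoutGroundState` = the crux with the ground-state hypothesis dropped.
* `periodicGivenLayered_false_without_groundState`: **layered windows do not imply periodic windows without
  energetics.**  Witness `qpConfig`: the enumerated layered set with fcc registry (`constHagg`), `a = 1`, and
  quasi-periodic heights `qpHeight m = 41/50·m + 3/100·fract(m√2)` (increments `≈ 0.8024, 0.8324`, in the
  box).  A period `g` with `g₃ ≠ 0` (full rank) would force a chain of `M + 1` layer heights with differences
  `g₃ ± 2ε`; the index step is pinned to `round (g₃/(41/50))`, the fractional increments lie in `{β, β−1}`,
  `β = fract(k√2) ∈ (0,1)` (`irrational_sqrt_two`), are all equal and telescope into `(−1,1)`: impossible for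
  `M > 1/β, 1/(1−β)`.  MESSAGE: a proof of the crux must use the LJ energetics to pin the free interlayer
  spacings of the `LayeredWindows` format; the stacking word is a second, independent freedom.
* `not_periodicGivenLayeredFor_zero`: the witness is a ground-state sequence of the zero potential — no
  potential-uniform proof (compare `not_isCrystallizing_zero`).  All `[folklore]`.
-/

noncomputable section

namespace Summit.AtomisticToContinuum.Crystallization.Theorems.PeriodicGivenLayered.Negative.SpacingFreedom

open scoped BigOperators
open Filter Set Literature.MathematicalPhysics.StatisticalMechanics

local notation "E3" => EuclideanSpace ℝ (Fin 3)

/-- LAYERED WINDOWS of a sequence of finite configurations — the hypothesis of the crux, verbatim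
(the statement of `LayeredWindows`, stmt-11778, for the given sequence). -/
def HasLayeredWindows (x : (N : ℕ) → (Fin N → E3)) : Prop :=
  ∃ a : ℝ, 47 / 50 ≤ a ∧ a ≤ 1 ∧ ∀ R ε : ℝ, 0 < ε → ∃ᶠ N in Filter.atTop,
    ∃ (A : EuclideanSpace ℝ (Fin 3) →ₗᵢ[ℝ] EuclideanSpace ℝ (Fin 3)) (t : EuclideanSpace ℝ (Fin 3))
      (s : ℤ → ℤ) (z : ℤ → ℝ), IsHaggSeq s ∧
      (∀ m : ℤ, 39 / 50 * a ≤ z (m + 1) - z m ∧ z (m + 1) - z m ≤ 17 / 20 * a) ∧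
      let S : Set (EuclideanSpace ℝ (Fin 3)) := {p | ∃ m i j : ℤ, p = A (((i : ℝ) • triangularVec₁ a) +
        ((j : ℝ) • triangularVec₂ a) + ((haggLabel s m : ℝ) • barlowOffset a) + (z m • layerNormal 1))};
      (∀ p ∈ S, ‖p‖ ≤ R → ∃ i : Fin N, dist (x N i + t) p ≤ ε) ∧
      (∀ i : Fin N, ‖x N i + t‖ ≤ R → ∃ p ∈ S, dist (x N i + t) p ≤ ε)

/-- PERIODIC WINDOWS of a sequence of finite configurations — the conclusion of the crux, verbatim
(the statement of `PeriodicWindows`, stmt-3240, for the given sequence). -/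
def HasPeriodicWindows (x : (N : ℕ) → (Fin N → E3)) : Prop :=
  ∃ P : PeriodicConfiguration 3, ∀ R ε : ℝ, 0 < ε → ∃ᶠ N in Filter.atTop,
    ∃ t : EuclideanSpace ℝ (Fin 3),
      (∀ s ∈ P.points, ‖s‖ ≤ R → ∃ i : Fin N, dist (x N i + t) s ≤ ε) ∧
      (∀ i : Fin N, ‖x N i + t‖ ≤ R → ∃ s ∈ P.points, dist (x N i + t) s ≤ ε)

/-- The crux parametrised by the pair potential. -/
def PeriodicGivenLayeredFor (V : ℝ → ℝ) : Prop :=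
  ∀ x : (N : ℕ) → (Fin N → E3), (∀ N, IsGroundState V (x N)) →
    HasLayeredWindows x → HasPeriodicWindows x

/-- At `V = lennardJones` this is literally the crux. [folklore] -/
theorem periodicGivenLayeredFor_lennardJones_iff :
    PeriodicGivenLayeredFor lennardJones ↔
      Summit.AtomisticToContinuum.Crystallization.Theses.PhononSlackCertificates.PeriodicGivenLayered :=
  Iff.rfl

/-- The crux WITHOUT the ground-state hypothesis: layered windows ⇒ periodic windows for EVERY
sequence of finite configurations. -/
def PeriodicGivenLayeredWithoutGroundState : Prop :=
  ∀ x : (N : ℕ) → (Fin N → E3), HasLayeredWindows x → HasPeriodicWindows x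

/-- The dropped-hypothesis form implies the crux (so its failure is informative, not fatal). [folklore] -/
theorem periodicGivenLayered_of_without (h : PeriodicGivenLayeredWithoutGroundState) :
    Summit.AtomisticToContinuum.Crystallization.Theses.PhononSlackCertificates.PeriodicGivenLayered :=
  fun x _ hx => h x hx

/-- Quasi-periodic layer heights `z m = 41/50·m + 3/100·fract(m √2)`. -/
def qpHeight (m : ℤ) : ℝ := 41 / 50 * m + 3 / 100 * Int.fract ((m : ℝ) * √2)

/-- Height differences in closed form. [folklore] -/
theorem qpHeight_sub (m m' : ℤ) :
    qpHeight m' - qpHeight m =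
      41 / 50 * ((m' - m : ℤ) : ℝ) + 3 / 100 * (Int.fract ((m' : ℝ) * √2) - Int.fract ((m : ℝ) * √2)) := by
  unfold qpHeight; push_cast; ring

/-- The increments lie in the admissible box `[39/50, 17/20]` (for `a = 1`). [folklore] -/
theorem qpHeight_spacing (m : ℤ) :
    39 / 50 * (1 : ℝ) ≤ qpHeight (m + 1) - qpHeight m ∧ qpHeight (m + 1) - qpHeight m ≤ 17 / 20 * (1 : ℝ) := by
  have h := qpHeight_sub m (m + 1)
  have h0 := Int.fract_nonneg (((m + 1 : ℤ) : ℝ) * √2); have h1 := Int.fract_lt_one (((m + 1 : ℤ) : ℝ) * √2)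
  have h2 := Int.fract_nonneg ((m : ℝ) * √2); have h3 := Int.fract_lt_one ((m : ℝ) * √2)
  simp only [add_sub_cancel_left, Int.cast_one] at h
  constructor <;> linarith

/-- The heights increase strictly. [folklore] -/
theorem qpHeight_strictMono : StrictMono qpHeight :=
  strictMono_int_of_lt_succ fun m => by have := (qpHeight_spacing m).1; linarith

/-- `fract (x + y) - fract x ∈ {fract y, fract y - 1}`. [folklore] -/
theorem fract_add_sub_fract (x y : ℝ) :
    Int.fract (x + y) - Int.fract x = Int.fract y ∨ Int.fract (x + y) - Int.fract x = Int.fract y - 1 := by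
  obtain ⟨e, he⟩ := Int.fract_add x y
  have h0 := Int.fract_nonneg (x + y); have h1 := Int.fract_lt_one (x + y)
  have h2 := Int.fract_nonneg x; have h3 := Int.fract_lt_one x
  have h4 := Int.fract_nonneg y; have h5 := Int.fract_lt_one y
  have he1 : (e : ℝ) < 1 := by linarith
  have he2 : (-2 : ℝ) < e := by linarith
  have : e = 0 ∨ e = -1 := by have := (show e < 1 by exact_mod_cast he1); have := (show -2 < e by exact_mod_cast he2); omega
  rcases this with rfl | rfl
  · left; push_cast at he; linarith
  · right; push_cast at he; linarith

/-- ROUNDING: a height difference within `2ε ≤ 1/200` of `γ` pins the layer-index step to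
`round (γ / (41/50))`. [folklore] -/
theorem step_eq_round {γ ε : ℝ} (hε : ε ≤ 1 / 400) {m m' : ℤ}
    (h : |qpHeight m' - qpHeight m - γ| ≤ 2 * ε) : m' - m = round (γ / (41 / 50)) := by
  have hsub := qpHeight_sub m m'
  have hρb : |γ / (41 / 50) - round (γ / (41 / 50))| ≤ 1 / 2 := abs_sub_round _
  set ρ : ℤ := round (γ / (41 / 50)) with hρ; set k : ℤ := m' - m with hk
  have hf1 := Int.fract_nonneg ((m' : ℝ) * √2); have hf2 := Int.fract_lt_one ((m' : ℝ) * √2)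
  have hf3 := Int.fract_nonneg ((m : ℝ) * √2); have hf4 := Int.fract_lt_one ((m : ℝ) * √2)
  rw [show γ / (41 / 50) = 50 / 41 * γ by ring] at hρb; rw [abs_le] at h hρb
  have hlt : |(k : ℝ) - ρ| < 1 := by
    rw [abs_lt]; constructor <;> nlinarith [h.1, h.2, hρb.1, hρb.2]
  rw [abs_lt] at hlt
  have h5 : k - ρ < 1 := by exact_mod_cast (show ((k : ℝ) - ρ) < 1 from hlt.2)
  have h6 : -1 < k - ρ := by exact_mod_cast (show (-1 : ℝ) < (k : ℝ) - ρ from hlt.1)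
  omega

/-- NUMBER THEORY CORE: no non-zero real `γ` admits, for every `M` and `ε > 0`, a chain of `M + 1`
quasi-periodic heights with consecutive differences within `2ε` of `γ`. [folklore] -/
theorem no_height_chain {γ : ℝ} (hγ : γ ≠ 0)
    (chain : ∀ (M : ℕ) (ε : ℝ), 0 < ε →
      ∃ m : ℕ → ℤ, ∀ n < M, |qpHeight (m (n + 1)) - qpHeight (m n) - γ| ≤ 2 * ε) : False := by
  set r : ℤ := round (γ / (41 / 50)) with hr
  by_cases hr0 : r = 0
  · -- step 0: consecutive heights coincide, so |γ| ≤ 2ε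
    have hγpos : 0 < |γ| := abs_pos.2 hγ
    obtain ⟨m, hm⟩ := chain 1 (min (1 / 400) (|γ| / 8)) (lt_min (by norm_num) (by positivity))
    have h := hm 0 zero_lt_one
    have hk := step_eq_round (min_le_left _ _) h
    rw [← hr, hr0] at hk
    have h01 : m (0 + 1) = m 0 := by omega
    rw [h01, sub_self, zero_sub, abs_neg] at h
    have : |γ| ≤ |γ| / 4 := h.trans (by linarith [min_le_right (1 / 400 : ℝ) (|γ| / 8)])
    linarith
  · -- step r ≠ 0: the fractional increments are all `β` or all `β - 1`
    set β : ℝ := Int.fract ((r : ℝ) * √2) with hβ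
    have hβ0 : 0 < β := by
      rcases (Int.fract_nonneg ((r : ℝ) * √2)).lt_or_eq with h | h
      · exact h
      · exfalso
        have hirr : Irrational ((r : ℝ) * √2) := irrational_sqrt_two.intCast_mul hr0
        apply hirr.ne_int ⌊(r : ℝ) * √2⌋
        have := Int.fract_add_floor ((r : ℝ) * √2)
        rw [← hβ] at this; rw [← hβ] at h
        linarith
    have hβ1 : β < 1 := Int.fract_lt_one _
    obtain ⟨M, hM⟩ := exists_nat_gt (max (1 / β) (1 / (1 - β)))
    have hMβ : 1 < (M : ℝ) * β := (div_lt_iff₀ hβ0).1 ((le_max_left _ _).trans_lt hM)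
    have hMβ' : 1 < (M : ℝ) * (1 - β) := (div_lt_iff₀ (by linarith)).1 ((le_max_right _ _).trans_lt hM)
    obtain ⟨m, hm⟩ := chain M (1 / 400) (by norm_num)
    have hstep : ∀ n < M, m (n + 1) = m n + r := fun n hn => by
      have := step_eq_round le_rfl (hm n hn); omega
    -- the phases
    set φ : ℕ → ℝ := fun n => Int.fract (((m n : ℤ) : ℝ) * √2) with hφ
    have hd : ∀ n < M, φ (n + 1) - φ n = β ∨ φ (n + 1) - φ n = β - 1 := by
      intro n hn
      have e : ((m (n + 1) : ℤ) : ℝ) * √2 = ((m n : ℤ) : ℝ) * √2 + (r : ℝ) * √2 := by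
        rw [hstep n hn]; push_cast; ring
      simp only [hφ]
      rw [e]
      exact fract_add_sub_fract _ _
    have hclose : ∀ n < M, |3 / 100 * (φ (n + 1) - φ n) - (γ - 41 / 50 * r)| ≤ 2 * (1 / 400) := by
      intro n hn
      have h := hm n hn
      have hsub := qpHeight_sub (m n) (m (n + 1))
      have hk : ((m (n + 1) - m n : ℤ) : ℝ) = r := by rw [hstep n hn]; push_cast; ring
      rw [hk] at hsub
      rw [hsub] at h
      simp only [hφ]
      convert h using 2
      ring
    -- all increments equal the first one
    have hall : ∀ n < M, φ (n + 1) - φ n = φ 1 - φ 0 := by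
      intro n hn
      have hM0 : 0 < M := lt_of_le_of_lt (Nat.zero_le n) hn
      have c1 := hclose n hn
      have c0 := hclose 0 hM0
      rw [abs_le] at c1 c0
      rcases hd n hn with h1 | h1 <;> rcases hd 0 hM0 with h2 | h2
      · rw [h1, h2]
      · exfalso; simp only [zero_add] at h2 c0; rw [h1] at c1; rw [h2] at c0; linarith [c1.1, c1.2, c0.1, c0.2]
      · exfalso; simp only [zero_add] at h2 c0; rw [h1] at c1; rw [h2] at c0; linarith [c1.1, c1.2, c0.1, c0.2]
      · rw [h1, h2]
    -- telescope
    have htel : ∑ n ∈ Finset.range M, (φ (n + 1) - φ n) = φ M - φ 0 := Finset.sum_range_sub φ M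
    have hconst : ∑ n ∈ Finset.range M, (φ (n + 1) - φ n) = M * (φ 1 - φ 0) := by
      rw [Finset.sum_congr rfl fun n hn => hall n (Finset.mem_range.1 hn), Finset.sum_const,
        Finset.card_range, nsmul_eq_mul]
    have hφM0 := Int.fract_nonneg (((m M : ℤ) : ℝ) * √2); have hφM1 := Int.fract_lt_one (((m M : ℤ) : ℝ) * √2)
    have hφ00 := Int.fract_nonneg (((m 0 : ℤ) : ℝ) * √2); have hφ01 := Int.fract_lt_one (((m 0 : ℤ) : ℝ) * √2)
    have hrange : -1 < (M : ℝ) * (φ 1 - φ 0) ∧ (M : ℝ) * (φ 1 - φ 0) < 1 := by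
      rw [← hconst, htel]; simp only [hφ]; constructor <;> linarith
    have hM0 : 0 < M := Nat.pos_of_ne_zero (by rintro rfl; norm_num at hMβ)
    rcases hd 0 hM0 with h1 | h1
    · simp only [zero_add] at h1; rw [h1] at hrange; linarith [hrange.2]
    · simp only [zero_add] at h1; rw [h1] at hrange; nlinarith [hrange.1]

/-- A full-rank lattice of `ℝ³` contains a vector with non-zero third coordinate. [folklore] -/
theorem exists_mem_lattice_apply_two_ne_zero (P : PeriodicConfiguration 3) :
    ∃ g ∈ P.lattice, g 2 ≠ 0 := by
  by_contra h
  push Not at h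
  have hspan : Submodule.span ℝ ((P.lattice : Submodule ℤ E3) : Set E3) = ⊤ := IsZLattice.span_top
  have key : ∀ v ∈ Submodule.span ℝ ((P.lattice : Submodule ℤ E3) : Set E3), v 2 = 0 := by
    intro v hv
    induction hv using Submodule.span_induction with
    | mem v hv => exact h v hv
    | zero => simp
    | add u v _ _ hu hv => simp [hu, hv]
    | smul c v _ hv => simp [hv]
  have hmem : EuclideanSpace.single (2 : Fin 3) (1 : ℝ) ∈
      Submodule.span ℝ ((P.lattice : Submodule ℤ E3) : Set E3) := by
    rw [hspan]; trivial
  have := key _ hmem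
  simp at this

/-- If every particle of every `x N` has its third coordinate among the quasi-periodic heights,
then `x` has NO periodic windows.  Only the first matching clause (every site of `P` in the ball is
near a particle) is used. [folklore] -/
theorem not_hasPeriodicWindows_of_heights (x : (N : ℕ) → (Fin N → E3))
    (hx : ∀ N (i : Fin N), ∃ m : ℤ, x N i 2 = qpHeight m) : ¬ HasPeriodicWindows x := by
  rintro ⟨P, hP⟩
  obtain ⟨g, hg, hγ⟩ := exists_mem_lattice_apply_two_ne_zero P
  obtain ⟨s₀, hs₀⟩ := P.points_nonempty
  refine no_height_chain hγ fun M ε hε => ?_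
  obtain ⟨N, t, h1, -⟩ := (hP (‖s₀‖ + M * ‖g‖) ε hε).exists
  have hpt : ∀ n : ℕ, n ≤ M → ∃ m : ℤ, |qpHeight m + t 2 - (s₀ 2 + (n : ℝ) * g 2)| ≤ ε := by
    intro n hn
    have hmem : s₀ + (n : ℝ) • g ∈ P.points := by
      refine P.add_mem_points hs₀ ?_
      rw [Nat.cast_smul_eq_nsmul]
      exact nsmul_mem hg n
    have hnorm : ‖s₀ + (n : ℝ) • g‖ ≤ ‖s₀‖ + M * ‖g‖ := by
      calc ‖s₀ + (n : ℝ) • g‖ ≤ ‖s₀‖ + ‖(n : ℝ) • g‖ := norm_add_le _ _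
        _ = ‖s₀‖ + n * ‖g‖ := by rw [norm_smul, Real.norm_eq_abs, Nat.abs_cast]
        _ ≤ ‖s₀‖ + M * ‖g‖ := by gcongr
    obtain ⟨i, hi⟩ := h1 _ hmem hnorm
    obtain ⟨m, hm⟩ := hx N i
    refine ⟨m, ?_⟩
    have h2 := (PiLp.dist_apply_le (x N i + t) (s₀ + (n : ℝ) • g) 2).trans hi
    rw [Real.dist_eq] at h2
    simpa [hm] using h2
  choose! m hm using hpt
  refine ⟨m, fun n hn => ?_⟩
  have h0 := hm n hn.le
  have h1 := hm (n + 1) hn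
  rw [abs_le] at h0 h1 ⊢
  push_cast at h1
  constructor <;> linarith [h0.1, h0.2, h1.1, h1.2]

/-- The point `(m, i, j)` of the layered set: fcc registry (`constHagg`), `a = 1`, heights
`qpHeight`; written in the exact format of the crux's layered set `S`. -/
def qpPoint (q : ℤ × ℤ × ℤ) : E3 :=
  ((q.2.1 : ℝ) • triangularVec₁ 1) + ((q.2.2 : ℝ) • triangularVec₂ 1) +
    ((haggLabel constHagg q.1 : ℝ) • barlowOffset 1) + (qpHeight q.1 • layerNormal 1)

/-- First coordinate of a layered point. [folklore] -/
@[simp] theorem qpPoint_apply_zero (q : ℤ × ℤ × ℤ) :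
    qpPoint q 0 = q.2.1 + q.2.2 / 2 + q.1 / 2 := by
  simp [qpPoint, triangularVec₁, triangularVec₂, barlowOffset, layerNormal]; ring

/-- Second coordinate of a layered point. [folklore] -/
@[simp] theorem qpPoint_apply_one (q : ℤ × ℤ × ℤ) :
    qpPoint q 1 = √3 / 6 * (3 * q.2.2 + q.1) := by
  simp [qpPoint, triangularVec₁, triangularVec₂, barlowOffset, layerNormal]; ring

/-- Third coordinate of a layered point: its quasi-periodic height. [folklore] -/
@[simp] theorem qpPoint_apply_two (q : ℤ × ℤ × ℤ) : qpPoint q 2 = qpHeight q.1 := by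
  simp [qpPoint, triangularVec₁, triangularVec₂, barlowOffset, layerNormal]

/-- A fixed enumeration of the index set `ℤ³`. -/
def idx : ℤ × ℤ × ℤ ≃ ℕ := Denumerable.eqv _

/-- THE WITNESS SEQUENCE: `x N` lists the first `N` points of the layered set. -/
def qpConfig (N : ℕ) (i : Fin N) : E3 := qpPoint (idx.symm i)

/-- Every particle of the witness sits at a quasi-periodic height. [folklore] -/
theorem qpConfig_apply_two (N : ℕ) (i : Fin N) : ∃ m : ℤ, qpConfig N i 2 = qpHeight m :=
  ⟨(idx.symm i).1, by simp [qpConfig]⟩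

/-- Only finitely many points of the layered set lie in a ball. [folklore] -/
theorem finite_setOf_norm_qpPoint_le (R : ℝ) : {q : ℤ × ℤ × ℤ | ‖qpPoint q‖ ≤ R}.Finite := by
  set K : ℤ := ⌈7 * R + 2⌉ with hK
  refine ((Set.finite_Icc (-K) K).prod ((Set.finite_Icc (-K) K).prod (Set.finite_Icc (-K) K))).subset ?_
  rintro ⟨m, i, j⟩ hq
  simp only [Set.mem_setOf_eq] at hq
  have hR : 0 ≤ R := (norm_nonneg _).trans hq
  have h2 : |qpHeight m| ≤ R := by
    have := (PiLp.norm_apply_le (qpPoint (m, i, j)) 2).trans hq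
    simpa using this
  have h1 : √3 / 6 * |3 * (j : ℝ) + m| ≤ R := by
    have := (PiLp.norm_apply_le (qpPoint (m, i, j)) 1).trans hq
    rw [qpPoint_apply_one, Real.norm_eq_abs, abs_mul,
      abs_of_pos (by positivity : (0 : ℝ) < √3 / 6)] at this
    exact this
  have h0 : |(i : ℝ) + j / 2 + m / 2| ≤ R := by
    have := (PiLp.norm_apply_le (qpPoint (m, i, j)) 0).trans hq
    simpa using this
  have hm : |(m : ℝ)| ≤ 2 * R + 1 := by
    unfold qpHeight at h2
    have hf0 := Int.fract_nonneg ((m : ℝ) * √2); have hf1 := Int.fract_lt_one ((m : ℝ) * √2)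
    rw [abs_le] at h2 ⊢
    constructor <;> linarith [h2.1, h2.2]
  have hs : (1 : ℝ) ≤ √3 := by
    have h := Real.sqrt_le_sqrt (show (1 : ℝ) ≤ 3 by norm_num)
    rwa [Real.sqrt_one] at h
  have hj : |(j : ℝ)| ≤ 4 * R + 1 := by
    have h3 : |3 * (j : ℝ) + m| ≤ 6 * R := by
      have : 1 / 6 * |3 * (j : ℝ) + m| ≤ √3 / 6 * |3 * (j : ℝ) + m| :=
        mul_le_mul_of_nonneg_right (by linarith) (abs_nonneg _)
      linarith
    rw [abs_le] at h3 hm ⊢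
    constructor <;> linarith [h3.1, h3.2, hm.1, hm.2]
  have hi : |(i : ℝ)| ≤ 7 * R + 2 := by
    rw [abs_le] at h0 hm hj ⊢
    constructor <;> linarith [h0.1, h0.2, hm.1, hm.2, hj.1, hj.2]
  have hKR : (7 * R + 2 : ℝ) ≤ K := Int.le_ceil _
  have bound : ∀ n : ℤ, |(n : ℝ)| ≤ 7 * R + 2 → n ∈ Set.Icc (-K) K := fun n hn => by
    have h' : |(n : ℝ)| ≤ K := hn.trans hKR
    rw [abs_le] at h'
    exact ⟨by exact_mod_cast h'.1, by exact_mod_cast h'.2⟩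
  exact ⟨bound m (hm.trans (by linarith)), bound i hi, bound j (hj.trans (by linarith))⟩

/-- The witness HAS layered windows (it is an admissible layered set, enumerated). [folklore] -/
theorem hasLayeredWindows_qpConfig : HasLayeredWindows qpConfig := by
  refine ⟨1, by norm_num, le_rfl, fun R ε hε => Filter.Eventually.frequently ?_⟩
  obtain ⟨B, hB⟩ := ((finite_setOf_norm_qpPoint_le R).image idx).bddAbove
  rw [Filter.eventually_atTop]
  refine ⟨B + 1, fun N hN => ⟨LinearIsometry.id, 0, constHagg, qpHeight, isHaggSeq_const,
    qpHeight_spacing, ?_⟩⟩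
  constructor
  · rintro p ⟨m, i, j, rfl⟩ hp
    have hq : (m, i, j) ∈ {q : ℤ × ℤ × ℤ | ‖qpPoint q‖ ≤ R} := by
      simpa [qpPoint] using hp
    have hle : idx (m, i, j) ≤ B := hB (Set.mem_image_of_mem idx hq)
    refine ⟨⟨idx (m, i, j), by omega⟩, ?_⟩
    simp [qpConfig, qpPoint, hε.le]
  · intro i _
    refine ⟨qpConfig N i, ⟨(idx.symm i).1, (idx.symm i).2.1, (idx.symm i).2.2, ?_⟩, by simp [hε.le]⟩
    simp [qpConfig, qpPoint]

/-- **LOAD-BEARING (a).** Without the ground-state hypothesis the crux is false: layered windows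
at every scale do NOT imply periodic windows — the free interlayer spacings of the
`LayeredWindows` format admit quasi-periodic height sequences inside the box.  Any proof of
`PeriodicGivenLayered` must use the energetics of Lennard-Jones ground states to pin the spacings
(and the stacking). [folklore] -/
theorem periodicGivenLayered_false_without_groundState : ¬ PeriodicGivenLayeredWithoutGroundState :=
  fun h => not_hasPeriodicWindows_of_heights qpConfig qpConfig_apply_two (h qpConfig hasLayeredWindows_qpConfig)

/-- Distinct indices give distinct layered points. [folklore] -/
theorem qpPoint_injective : Function.Injective qpPoint := by
  rintro ⟨m, i, j⟩ ⟨m', i', j'⟩ h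
  have h2 := congrArg (fun v : E3 => v 2) h; have h1 := congrArg (fun v : E3 => v 1) h
  have h0 := congrArg (fun v : E3 => v 0) h
  simp only [qpPoint_apply_two, qpPoint_apply_one, qpPoint_apply_zero] at h2 h1 h0
  have hm : m = m' := qpHeight_strictMono.injective h2
  subst hm
  have hs : (0 : ℝ) < √3 := by positivity
  have hj : (j : ℝ) = j' := by
    have := mul_left_cancel₀ (by positivity : (√3 / 6 : ℝ) ≠ 0) h1
    linarith
  obtain rfl : j = j' := by exact_mod_cast hj
  obtain rfl : i = i' := by exact_mod_cast (show (i : ℝ) = i' by linarith)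
  rfl

/-- The witness configurations consist of distinct points. [folklore] -/
theorem qpConfig_injective (N : ℕ) : Function.Injective (qpConfig N) := fun i j h =>
  Fin.ext (by simpa using congrArg idx (qpPoint_injective h))

/-- **(a′) No potential-uniform proof.** For the zero potential every injective configuration is a
ground state (`isGroundState_zero`), so the witness refutes `PeriodicGivenLayeredFor 0`; compare
`not_isCrystallizing_zero` in the Literature file. [folklore] -/
theorem not_periodicGivenLayeredFor_zero : ¬ PeriodicGivenLayeredFor (fun _ => 0) := fun h =>
  not_hasPeriodicWindows_of_heights qpConfig qpConfig_apply_two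
    (h qpConfig (fun N => isGroundState_zero (qpConfig_injective N)) hasLayeredWindows_qpConfig)

end Summit.AtomisticToContinuum.Crystallization.Theorems.PeriodicGivenLayered.Negative.SpacingFreedom

end
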